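import Mathlib
import Summits.ResolutionOfSingularities.ResolutionOfSingularities.Theorems.WeightedInvariantLocalWeightedDropWildMonicFlagDropAxisPackage
import Summits.ResolutionOfSingularities.ResolutionOfSingularities.Theorems.WeightedInvariantLocalWeightedDropWildMonicFlagDropTangentStep
import Summits.ResolutionOfSingularities.ResolutionOfSingularities.Theorems.WeightedInvariantLocalWeightedDropWildMonicFlagDropTangentInduced
import Summits.ResolutionOfSingularities.ResolutionOfSingularities.Theorems.WeightedInvariantLocalWeightedDropWildMonicFlagDropTools
import Summits.ResolutionOfSingularities.ResolutionOfSingularities.Theorems.WeightedInvariantLocalWeightedDropWildMonicCleanRep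

/-!
# `WeightedInvariant.LocalWeightedDrop`, line `hasse-ridge-face-selection`, S3ρ: Uk-ρD1 — the INDUCED child hypersurface of an axis step
# and items (iv) / (vi) of `AxisPackageN0` (Perlega Prop. 9.1.1 for `n_F = 0`)

Crux item stmt-ResolutionOfSingularities-8899 `LocalWeightedDrop` (route `ResolutionOfSingularities/WeightedInvariant`), engine of the door
`HypersurfaceCentreConstruction` stmt-ResolutionOfSingularities-19897.  [OURS · L1 W4.3, chain w43, res-D-pv-005 AS res-L1-w43-stub-7, hand of
Uk-ρD1 (`axisPackageN0_holds`, res-type-083's CUT 2026-08-27T09:03Z).  MODEL: S. Perlega, arXiv:2011.14443 Prop. 9.1.1 (p0103): for a flag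
`F` with `n_F = 0` and its INDUCED flag `F′` at the axis point: «`n_{F′} = 0`, `d_{F′} ≤ d_F`, and `d_{F′} = d_F ∧ s_F < ∞ ⇒ s_{F′} < s_F`».
Nothing here is a statement of H. Hironaka's manuscript [claim: Hironaka2017, status: under-review]; OUR objects.]

* `succE_zero_eq_excNext` — stub-1's successor boundary at the axis point is stub-7's `excNext`;
* `factorial_lt_wMin_of_isPos`, `coeff_X₀_eq_zero_of_wMin_le` — at a POSITION `m_{(1,1)} > d!`, so a re-centring that does not lower
  `m_{(1,1)}` has NO LINEAR `x₀`-term (Lemma 5.1.1 (3)); hence its induced child re-centring vanishes at the origin;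
* `exists_induced_hypersurface` — the induced child hypersurface `g₀′` (`g₀′(0) = 0`) of a parent hypersurface `g₀`: the child flag tuple of
  `(g₀′, 0)` is the AXIS SUCCESSOR of the parent flag tuple of `(g₀, 0)` (res-D-pv-056's `exists_induced_flagTuple`, res-type-083's
  `exists_dirChart_zero_eq_X_mul`);
* `newtonSet_induced`, `dRes_induced_le` (item (iv)), `sValue_induced_lt_or` (item (vi)) — the scaled Newton set of the induced child tuple is
  `Ψ_{d!}` of the parent's (`newtonSet_axisSucc`), so stub-7's transport laws `dRes_excNext_image_psi_le` / `sValue_excNext_image_psi_lt`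
  (p500828) give Prop. 9.1.1.
-/

set_option linter.dupNamespace false -- mandated namespace of this single-conjunct summit

noncomputable section

namespace Summit.ResolutionOfSingularities.ResolutionOfSingularities.Theorems

namespace WildMonic

open MvPowerSeries MonicDescent Literature.AlgebraicGeometry.Resolution
open PurePowerFlag (succE)

variable {k : Type} [Field k] {d : ℕ}

/-- Stub-1's successor boundary at the axis point `t = 0` is `excNext`. -/
theorem succE_zero_eq_excNext (E : Finset (Fin 2)) : succE (0 : k) E = excNext E := by
  ext i
  rw [mem_excNext_iff]
  unfold succE
  by_cases h1 : (1 : Fin 2) ∈ E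
  · rw [if_pos ⟨rfl, h1⟩]
    fin_cases i <;> simp [h1]
  · rw [if_neg (fun h => h1 h.2)]
    fin_cases i <;> simp [h1]

/-- AT A POSITION, `m_{(1,1)} > d!`. -/
theorem factorial_lt_wMin_of_isPos (hd : 0 < d) {A : Fin d → MvPowerSeries (Fin 2) k} (hA : IsPos d A) :
    (d.factorial : ℕ∞) < wMin ![1, 1] A := by
  by_cases htop : wMin ![1, 1] A = ⊤
  · rw [htop]; exact ENat.coe_lt_top _
  obtain ⟨n, hn⟩ := ENat.ne_top_iff_exists.mp htop
  rw [← hn]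
  have h := (le_wMin_iff_newtonSet ![1, 1] A).mp (le_of_eq hn)
  obtain ⟨i, hi⟩ := exists_slotWOrd_eq_wMin ![1, 1] A hd
  -- the attaining slot has a monomial; its scaled point has total degree `> d!`
  have hAi : A i ≠ 0 := by
    intro h0
    apply htop
    rw [← hi]
    unfold slotWOrd
    rw [h0, weightedOrder_zero, ENat.mul_top (by exact_mod_cast (slotWeight_pos i).ne')]
  obtain ⟨e, he, hwe⟩ := exists_coeff_ne_zero_and_weightedOrder ![1, 1] (f := A i)
    (ENat.coe_toNat (by rwa [Ne, weightedOrder_eq_top_iff]))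
  have hP := factorial_lt_of_mem_newtonSet hA ⟨i, e, he, rfl⟩
  simp only [Finsupp.smul_apply, smul_eq_mul] at hP
  have hval : (n : ℕ∞) = ((slotWeight d i * Finsupp.weight ![1, 1] e : ℕ) : ℕ∞) := by
    rw [hn, ← hi]; unfold slotWOrd; rw [← hwe]; push_cast; rfl
  rw [Literature.AlgebraicGeometry.Resolution.WeightedShear.weight_fin_two] at hval
  have hn' : n = slotWeight d i * (1 * e 0 + 1 * e 1) := by exact_mod_cast hval
  rw [hn']
  exact_mod_cast (by rw [one_mul, one_mul, Nat.mul_add]; exact hP)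

/-- A re-centring `g₀` (`g₀(0) = 0`) of a POSITION that does not lower `m_{(1,1)}` HAS NO LINEAR `x₀`-TERM (else `d!·ord g₀ = d! < m` and
Lemma 5.1.1 (3) would give `m(shift) = d! < m`). -/
theorem coeff_X₀_eq_zero_of_wMin_le (hd : 0 < d) {A : Fin d → MvPowerSeries (Fin 2) k} (hA : IsPos d A) {g₀ : MvPowerSeries (Fin 2) k}
    (hle : wMin ![1, 1] A ≤ wMin ![1, 1] (shift d A g₀)) : coeff (Finsupp.single 0 1) g₀ = 0 := by
  by_contra hne
  have hord : g₀.weightedOrder ![1, 1] ≤ 1 := by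
    refine (weightedOrder_le _ hne).trans ?_
    rw [Literature.AlgebraicGeometry.Resolution.WeightedShear.weight_fin_two]
    simp
  have hpos := factorial_lt_wMin_of_isPos hd hA
  have hG : (d.factorial : ℕ∞) * g₀.weightedOrder ![1, 1] < wMin ![1, 1] A := by
    refine lt_of_le_of_lt ?_ hpos
    calc (d.factorial : ℕ∞) * g₀.weightedOrder ![1, 1] ≤ (d.factorial : ℕ∞) * 1 := by gcongr
      _ = (d.factorial : ℕ∞) := mul_one _
  have heq := wMin_shift_eq_of_gt ![1, 1] A g₀ hd hG
  rw [heq] at hle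
  exact absurd (lt_of_lt_of_le hG hle) (lt_irrefl _)

/-- THE INDUCED CHILD HYPERSURFACE: for an axis step `x^{d−j}·T_j = A_j(x, xy)`, a child re-centring `φ′` and a parent hypersurface `g₀`
(`g₀(0) = 0`, no linear `x₀`-term), there is `g₀′` with `g₀′(0) = 0` whose child flag tuple is the axis successor of the parent flag tuple:
`x^{d−j}·(flagTuple d (shift d T φ′) g₀′ 0)_j = (flagTuple d A g₀ 0)_j (x, xy)`. -/
theorem exists_induced_hypersurface {A T : Fin d → MvPowerSeries (Fin 2) k}
    (hT : ∀ j : Fin d, (X 0 : MvPowerSeries (Fin 2) k) ^ (d - (j : ℕ)) * T j = subst (PlaneGerm.dirChart (0 : k)) (A j))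
    {φ' : MvPowerSeries (Fin 2) k} (hφ' : constantCoeff φ' = 0) {g₀ : MvPowerSeries (Fin 2) k} (hg₀ : constantCoeff g₀ = 0)
    (hlin : coeff (Finsupp.single 0 1) g₀ = 0) :
    ∃ g₀' : MvPowerSeries (Fin 2) k, constantCoeff g₀' = 0 ∧
      ∀ j : Fin d, (X 0 : MvPowerSeries (Fin 2) k) ^ (d - (j : ℕ)) * flagTuple d (shift d T φ') g₀' 0 j =
        subst (PlaneGerm.dirChart (0 : k)) (flagTuple d A g₀ 0 j) := by
  obtain ⟨G, hG, hG0⟩ := exists_dirChart_zero_eq_X_mul g₀ hg₀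
  refine ⟨G - φ', by rw [map_sub, hG0, hlin, hφ', sub_zero], fun j => ?_⟩
  rw [flagTuple_zero_shear, flagTuple_zero_shear, shift_shift, sub_add_cancel]
  exact axisSuccessor_shift hT hG j

section Induced

variable {A T : Fin d → MvPowerSeries (Fin 2) k} (hA : IsPos d A) {φ' g₀ g₀' : MvPowerSeries (Fin 2) k}
  (hg₀ : constantCoeff g₀ = 0) (hg₀' : constantCoeff g₀' = 0) (hφ' : constantCoeff φ' = 0)
  (hind : ∀ j : Fin d, (X 0 : MvPowerSeries (Fin 2) k) ^ (d - (j : ℕ)) * flagTuple d (shift d T φ') g₀' 0 j =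
    subst (PlaneGerm.dirChart (0 : k)) (flagTuple d A g₀ 0 j))

include hA hg₀ hind in
/-- THE SCALED NEWTON SET OF THE INDUCED CHILD TUPLE IS `Ψ_{d!}` OF THE PARENT'S. -/
theorem newtonSet_induced :
    newtonSet (flagTuple d (shift d T φ') g₀' 0) = psi d.factorial '' newtonSet (flagTuple d A g₀ 0) :=
  newtonSet_axisSucc (flagTuple d A g₀ 0) (flagTuple d (shift d T φ') g₀' 0) hind fun j => le_order_flagTuple hA hg₀ (map_zero _) j

include hA hg₀ hind in
/-- ITEM (iv) OF `AxisPackageN0` (Perlega Prop. 9.1.1: `d_{F′} ≤ d_F`), for a parent position off `Exit₃`. -/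
theorem dRes_induced_le {p : ℕ} (hex : ¬ Exit₃ p d A) (E : Finset (Fin 2)) :
    dRes (succE (0 : k) E) (newtonSet (flagTuple d (shift d T φ') g₀' 0)) ≤ dRes E (newtonSet (flagTuple d A g₀ 0)) := by
  rw [newtonSet_induced hA hg₀ hind, succE_zero_eq_excNext]
  exact dRes_excNext_image_psi_le E (newtonSet_flagTuple_nonempty hex hg₀ (map_zero _))
    fun P hP => factorial_le_of_mem_newtonSet_flagTuple_zero hA hg₀ hP

include hA hg₀ hind in
/-- ITEM (vi) OF `AxisPackageN0` (Perlega Prop. 9.1.1: `d_{F′} = d_F ∧ s_F < ∞ ⇒ s_{F′} < s_F`), for a parent position off `Exit₃` with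
`d_F > 0`. -/
theorem sValue_induced_lt_or {p : ℕ} (hex : ¬ Exit₃ p d A) (E : Finset (Fin 2))
    (hpos : 0 < dRes E (newtonSet (flagTuple d A g₀ 0)))
    (hkeep : dRes (succE (0 : k) E) (newtonSet (flagTuple d (shift d T φ') g₀' 0)) = dRes E (newtonSet (flagTuple d A g₀ 0))) :
    sValue d.factorial (succE (0 : k) E) (newtonSet (flagTuple d (shift d T φ') g₀' 0)) <
        sValue d.factorial E (newtonSet (flagTuple d A g₀ 0)) ∨
      sValue d.factorial E (newtonSet (flagTuple d A g₀ 0)) = ⊤ := by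
  by_cases hfin : sValue d.factorial E (newtonSet (flagTuple d A g₀ 0)) = ⊤
  · exact Or.inr hfin
  left
  rw [newtonSet_induced hA hg₀ hind, succE_zero_eq_excNext] at hkeep ⊢
  exact sValue_excNext_image_psi_lt E (newtonSet_flagTuple_nonempty hex hg₀ (map_zero _))
    (fun P hP => factorial_le_of_mem_newtonSet_flagTuple_zero hA hg₀ hP) hkeep hpos hfin

end Induced

end WildMonic

end Summit.ResolutionOfSingularities.ResolutionOfSingularities.Theorems

end
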